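import Summits.ResolutionOfSingularities.ResolutionOfSingularities.Theorems.FrobeniusClosingPatchingRelPerfectCuspLineStepGlue
import Summits.ResolutionOfSingularities.ResolutionOfSingularities.Theorems.FrobeniusClosingPatchingRelPerfectChartStrictTransform
import Summits.ResolutionOfSingularities.ResolutionOfSingularities.Theorems.FrobeniusClosingPatchingRelPerfectChartPrincipal
import Summits.ResolutionOfSingularities.ResolutionOfSingularities.Theorems.FrobeniusClosingPatchingRelPerfectCoreRungTowerHypersurface
import HarnessLib

/-!
# Crux `PatchingRelPerfect` (stmt-ResolutionOfSingularities-16161), chain w52 — kernel certificate of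
# the NON-GRADED DEPTH-FOUR member `(x₃² + x₀³) + 𝔪⁶`, part 2b: the strict transform of `V(c′)`
# on the `a`-chart of the surface step (generic transport)

[OURS · L1 W5.2 · kernel (iii) beyond F6, CHAIN v2.0 §1 (C)] Part 2a (`…CuspDepthFourSurfaceStep.lean`,
p530733) left two PERSISTENCE facts on the `a`-chart `B₀` of `Bl_{(a, c′)} Spec B`: the pair
`(t′/1, c″)` is quasi-regular and `B₀/(t′/1, c″)` is regular.  This file supplies the generic
transport producing them from facts on `B` (note `NONGRADED-DEPTH4-MEMBER.md`, evidence #59):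

* `chartBase_bijective_fin_one` — the Rees chart of a principal ideal generated by a
  non-zero-divisor is the base (for any `x : Fin 1 → R`; cf. `ChartPrincipal`);
* `exists_strictEquiv` — `B₀/(c″) ≅ B/(c′)` sending `(r/1) mod c″` to `r mod c′`
  (`ChartStrictTransform.exists_strictTransformHom` for `J = {c′}` + the principal chart over `B/(c′)`);
* `isQuasiRegular_lift` — `(t′/1, c″)` is quasi-regular when `B₀`, `B/(c′)` are domains, `t̄′ ≠ 0`
  in `B/(c′)` and `c″ ≠ 0` (`CoreRungTower.isWeaklyRegular_pair_of_notMem` + the swap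
  `ChartPrincipal.isQuasiRegular_pair_swap`);
* `isRegularRing_quot_lift` — `B₀/(t′/1, c″) ≅ B/(t′, c′)` is regular when the latter is.

Part 2c (`…CuspDepthFourPersistence.lean`) applies them on the line step's `a`-chart.  FORMAT
evidence for the core on the `𝔪`-primary stratum; nothing here is a statement of the manuscript under
review.

## References

* The Stacks Project, Tags 0804, 0BIQ, 052Q. [StacksProject]
* U. Görtz, T. Wedhorn, *Algebraic Geometry I*, 2nd ed. 2020, Prop. 13.96 (2). [GortzWedhorn2020]
* H. Matsumura, *Commutative Ring Theory*, CUP 1986, Thm. 16.2 (i). [Matsumura1987]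
* Q. Liu, *Algebraic Geometry and Arithmetic Curves*, OUP 2002, Thm. 8.1.19 (a). [Liu2002]
-/

-- `Summit.<Summit>.<Sub>.Theorems` with `Sub = Summit` (single-conjunct summit, D-0017)
set_option linter.dupNamespace false

noncomputable section

open CategoryTheory CategoryTheory.Limits AlgebraicGeometry Literature.AlgebraicGeometry.Resolution
open scoped Pointwise nonZeroDivisors

namespace Summit.ResolutionOfSingularities.ResolutionOfSingularities.Theorems

universe u

namespace CuspDepthFour
/-! ## The principal Rees chart, for an arbitrary one-member family -/

/-- **The Rees chart of a principal ideal generated by a non-zero-divisor is the base ring**, for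
any `x : Fin 1 → R` (`ChartPrincipal.chartBase_bijective_of_singleton` for the literal `![g]`).
[cite: StacksProject, Tag 052Q] -/
theorem chartBase_bijective_fin_one {R : Type u} [CommRing R] (x : Fin 1 → R) (hg : x 0 ∈ R⁰) :
    Function.Bijective (chartBase x 0) := by
  have hrange : Set.range x = {x 0} := by
    ext y
    constructor
    · rintro ⟨k, rfl⟩
      have hk : k = 0 := Subsingleton.elim _ _
      rw [hk]; rfl
    · rintro rfl; exact ⟨0, rfl⟩
  let τ := blowupAlgebra.toBlowupAlgebra x 0
  have hτ : Function.Bijective τ := blowupAlgebra.toBlowupAlgebra_bijective x 0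
  have hτbase : ∀ r : R, τ (chartBase x 0 r) =
      algebraMap R (blowupAlgebra (Ideal.span (Set.range x)) (x 0)) r :=
    fun r => blowupAlgebra.toBlowupAlgebra_reesChartBase x 0 r
  have hle : Submonoid.powers (x 0) ≤ R⁰ := by
    rintro _ ⟨k, rfl⟩
    exact pow_mem hg k
  have hbot : blowupAlgebra (Ideal.span (Set.range x)) (x 0) ≤ ⊥ := by
    rw [blowupAlgebra]
    refine Algebra.adjoin_le ?_
    rintro y ⟨z, hz, rfl⟩
    rw [hrange, Ideal.mem_span_singleton'] at hz
    obtain ⟨r, rfl⟩ := hz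
    rw [SetLike.mem_coe, Algebra.mem_bot]
    refine ⟨r, ?_⟩
    rw [map_mul, mul_assoc, IsLocalization.Away.mul_invSelf, mul_one]
  constructor
  · intro r s hrs
    have h1 : τ (chartBase x 0 r) = τ (chartBase x 0 s) := by rw [hrs]
    rw [hτbase, hτbase] at h1
    have h2 : algebraMap R (Localization.Away (x 0)) r = algebraMap R (Localization.Away (x 0)) s :=
      congrArg Subtype.val h1
    exact IsLocalization.injective (Localization.Away (x 0)) hle h2
  · intro w
    obtain ⟨r, hr⟩ : ∃ r : R, algebraMap R (Localization.Away (x 0)) r = (τ w).1 := by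
      have hw := hbot (τ w).2
      rw [Algebra.mem_bot] at hw
      obtain ⟨r, hr⟩ := hw
      exact ⟨r, hr⟩
    refine ⟨r, hτ.1 ?_⟩
    rw [hτbase]
    exact Subtype.ext hr

/-! ## The strict transform of `V(c′)` on the `a`-chart of `Bl_{(a, c′)}`: generic transport -/

section Generic

variable {B : Type u} [CommRing B] (T A C : B)

local notation3 "yy" => (![A, C] : Fin 2 → B)
/-- `J = {c′}` on the `a`-chart of `Bl_{(a, c′)}`: complement `{a}` indexed by `Fin 1`. -/
local notation3 "emb0" => (fun _ : Fin 1 => (0 : Fin 2))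
/-- `J = {c′}` as a sub-family of the indices `≠ 0`. -/
local notation3 "jJ0" => (fun _ : Fin 1 => (⟨1, of_decide_eq_true rfl⟩ : {j : Fin 2 // j ≠ emb0 0}))
/-- The reduced one-member family `(ā)` over `B/(c′)`. -/
local notation3 "yb" => (fun k : Fin 1 => Ideal.Quotient.mk
  (Ideal.span (Set.range fun k : Fin 1 => yy (jJ0 k).1)) (yy (emb0 k)))

/-- The base ideal of `jJ0` is `(c′)`. [folklore] -/
theorem Q0_eq : Ideal.span (Set.range fun k : Fin 1 => yy (jJ0 k).1) = Ideal.span {C} := by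
  have : (fun k : Fin 1 => yy (jJ0 k).1) = fun _ => C := by funext k; rfl
  rw [this, Set.range_const]

/-- The exceptional ideal of `jJ0` on the `a`-chart is `(c″)`. [folklore] -/
theorem EJ0_eq : Ideal.span (Set.range fun k : Fin 1 => chartGen yy (emb0 0) (jJ0 k).1) =
    Ideal.span {chartGen yy 0 1} := by
  have : (fun k : Fin 1 => chartGen yy (emb0 0) (jJ0 k).1) = fun _ => chartGen yy 0 1 := by
    funext k; rfl
  rw [this, Set.range_const]

/-- `jJ0` and `emb0` cover all indices. [folklore] -/
theorem cov0 : ∀ j : Fin 2, (∃ k, emb0 k = j) ∨ ∃ k, (jJ0 k).1 = j := by decide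

set_option maxHeartbeats 800000 in
-- one `RingEquiv.ofBijective` composite across two `HomogeneousLocalization` chart rings
/-- **`B₀/(c″) ≅ B/(c′)`**: on the `a`-chart `B₀` of `Bl_{(a, c′)} Spec B` (`(a, c′)` quasi-regular,
`ā` a non-zero-divisor of `B/(c′)`), the quotient by the strict transform `c″ = c′/a` of `V(c′)` is
the base modulo `c′` — the strict transform of `V(c′) ⊇ V(a, c′)` is `Bl_{(ā)} Spec B/(c′) = Spec B/(c′)`
(`ChartStrictTransform.exists_strictTransformHom` + the principal Rees chart
`chartBase_bijective_fin_one`); the isomorphism sends `(r/1) mod c″` to `r mod c′`.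
[cite: GortzWedhorn2020, Prop. 13.96 (2)] [cite: StacksProject, Tag 052Q] -/
theorem exists_strictEquiv (hy : IsQuasiRegular yy)
    (hA : Ideal.Quotient.mk (Ideal.span {C}) A ∈ (B ⧸ Ideal.span {C})⁰) :
    ∃ e : (chartRing yy 0 ⧸ Ideal.span {chartGen yy 0 1}) ≃+* (B ⧸ Ideal.span {C}),
      ∀ r : B, e (Ideal.Quotient.mk _ (chartBase yy 0 r)) = Ideal.Quotient.mk _ r := by
  have hjJ0 : Function.Injective jJ0 := fun i j _ => Subsingleton.elim i j
  obtain ⟨Θ0, hΘ0, hΘ0base, -⟩ :=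
    ChartStrictTransform.exists_strictTransformHom yy emb0 0 jJ0 hy hjJ0 cov0
  have hyb0 : yb 0 ∈ (B ⧸ Ideal.span (Set.range fun k : Fin 1 => yy (jJ0 k).1))⁰ := by
    show Ideal.Quotient.mk _ A ∈ _
    rw [Q0_eq]; exact hA
  have hβ := chartBase_bijective_fin_one yb hyb0
  let e₁ : (chartRing yy 0 ⧸ Ideal.span (Set.range fun k : Fin 1 => chartGen yy (emb0 0) (jJ0 k).1)) ≃+*
      (B ⧸ Ideal.span (Set.range fun k : Fin 1 => yy (jJ0 k).1)) :=
    (RingEquiv.ofBijective Θ0 hΘ0).trans (RingEquiv.ofBijective (chartBase yb 0) hβ).symm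
  have he₁ : ∀ r : B, e₁ (Ideal.Quotient.mk _ (chartBase yy 0 r)) = Ideal.Quotient.mk _ r := by
    intro r
    show (RingEquiv.ofBijective (chartBase yb 0) hβ).symm (Θ0 _) = _
    rw [RingEquiv.symm_apply_eq, hΘ0base]
    rfl
  refine ⟨(Ideal.quotEquivOfEq (EJ0_eq A C).symm).trans (e₁.trans (Ideal.quotEquivOfEq (Q0_eq A C))), ?_⟩
  intro r
  show Ideal.quotEquivOfEq (Q0_eq A C) (e₁ (Ideal.quotEquivOfEq (EJ0_eq A C).symm
    (Ideal.Quotient.mk _ (chartBase yy 0 r)))) = _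
  rw [Ideal.quotEquivOfEq_mk, he₁, Ideal.quotEquivOfEq_mk]

/-- **Quasi-regularity of `(t′/1, c″)` on `B₀`** from `t̄′ ≠ 0` in the domain `B/(c′)`, `B₀` a domain
and `c″ ≠ 0`. [cite: Matsumura1987, Thm. 16.2 (i)] -/
theorem isQuasiRegular_lift [IsDomain (chartRing yy 0)] [IsDomain (B ⧸ Ideal.span {C})]
    (e : (chartRing yy 0 ⧸ Ideal.span {chartGen yy 0 1}) ≃+* (B ⧸ Ideal.span {C}))
    (he : ∀ r : B, e (Ideal.Quotient.mk _ (chartBase yy 0 r)) = Ideal.Quotient.mk _ r)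
    (hT : Ideal.Quotient.mk (Ideal.span {C}) T ≠ 0) (hC'' : chartGen yy 0 1 ≠ 0) :
    IsQuasiRegular (![chartBase yy 0 T, chartGen yy 0 1] : Fin 2 → chartRing yy 0) := by
  haveI : IsDomain (chartRing yy 0 ⧸ Ideal.span {chartGen yy 0 1}) := MulEquiv.isDomain _ e.toMulEquiv
  haveI : NoZeroDivisors (chartRing yy 0) := IsDomain.to_noZeroDivisors (chartRing yy 0)
  have hT0 : chartBase yy 0 T ∉ Ideal.span {chartGen yy 0 1} := by
    rw [← Ideal.Quotient.eq_zero_iff_mem]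
    intro h0
    apply hT
    rw [← he T, h0, map_zero]
  have hwr := CoreRungTower.isWeaklyRegular_pair_of_notMem (mem_nonZeroDivisors_of_ne_zero hC'') hT0
  have hq := isQuasiRegular_of_isWeaklyRegular _ hwr
  have e2 : (Fin.cons (chartGen yy 0 1) (fun _ : Fin 1 => chartBase yy 0 T) : Fin 2 → chartRing yy 0) =
      ![chartGen yy 0 1, chartBase yy 0 T] := by
    funext i; fin_cases i <;> rfl
  rw [e2] at hq
  exact ChartPrincipal.isQuasiRegular_pair_swap hq

set_option maxHeartbeats 400000 in
-- quotient transports across the strict-transform equivalence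
/-- **`B₀/(t′/1, c″)` is regular** when `B/(t′, c′)` is. [cite: Liu2002, Thm. 8.1.19 (a)] -/
theorem isRegularRing_quot_lift
    (e : (chartRing yy 0 ⧸ Ideal.span {chartGen yy 0 1}) ≃+* (B ⧸ Ideal.span {C}))
    (he : ∀ r : B, e (Ideal.Quotient.mk _ (chartBase yy 0 r)) = Ideal.Quotient.mk _ r)
    (h2 : IsRegularRing (B ⧸ (Ideal.span {T} ⊔ Ideal.span {C}))) :
    IsRegularRing (chartRing yy 0 ⧸ Ideal.span (Set.range
      (![chartBase yy 0 T, chartGen yy 0 1] : Fin 2 → chartRing yy 0))) := by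
  -- `B/(c′)/(t̄′) ≅ B/(t′, c′)` is regular
  have htarget : IsRegularRing ((B ⧸ Ideal.span {C}) ⧸
      (Ideal.span {T}).map (Ideal.Quotient.mk (Ideal.span {C}))) := by
    haveI := h2
    exact IsRegularRing.of_ringEquiv
      ((Ideal.quotEquivOfEq (sup_comm _ _)).trans (DoubleQuot.quotQuotEquivQuotSup _ _).symm)
  -- transport along `e`
  have hs : ((e.symm : (B ⧸ Ideal.span {C}) →+* (chartRing yy 0 ⧸ Ideal.span {chartGen yy 0 1})).comp
      (Ideal.Quotient.mk (Ideal.span {C}))) T =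
      Ideal.Quotient.mk (Ideal.span {chartGen yy 0 1}) (chartBase yy 0 T) := by
    show e.symm (Ideal.Quotient.mk (Ideal.span {C}) T) = _
    rw [RingEquiv.symm_apply_eq, he]
  have hsrc : IsRegularRing ((chartRing yy 0 ⧸ Ideal.span {chartGen yy 0 1}) ⧸
      (Ideal.span {chartBase yy 0 T}).map (Ideal.Quotient.mk (Ideal.span {chartGen yy 0 1}))) := by
    haveI := htarget
    refine IsRegularRing.of_ringEquiv (Ideal.quotientEquiv
      ((Ideal.span {T}).map (Ideal.Quotient.mk (Ideal.span {C})))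
      ((Ideal.span {chartBase yy 0 T}).map (Ideal.Quotient.mk (Ideal.span {chartGen yy 0 1}))) e.symm ?_)
    rw [Ideal.map_map, Ideal.map_span, Ideal.map_span, Set.image_singleton, Set.image_singleton, hs]
  haveI := hsrc
  rw [CuspMember.span_range_vec2 (chartBase yy 0 T) (chartGen yy 0 1),
    sup_comm (Ideal.span {chartBase yy 0 T}) (Ideal.span {chartGen yy 0 1})]
  exact IsRegularRing.of_ringEquiv (DoubleQuot.quotQuotEquivQuotSup _ _)

end Generic

end CuspDepthFour

end Summit.ResolutionOfSingularities.ResolutionOfSingularities.Theorems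

end
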